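import Summits.BirchSwinnertonDyer.BirchSwinnertonDyer.Theorems.ByReductionTypeAtTwoRankOneAtTwoBigImageOddLocalOneDoorSubsliceResidueShaTransport
import Literature.NumberTheory.EllipticCurves.ShaPrimaryModDivisibleSquare
import Literature.GroupTheory.FiniteAbelian.CharacterModuleUnitAddCircle
import HarnessLib

/-!
# Route ByReductionTypeAtTwo, crux `RankOneAtTwoBigImageOddLocal` (stmt-BirchSwinnertonDyer-23715): the CASSELS–TATE BIT of a finite `Ш[2^∞]`
# with `Ш[2] ≅ (ℤ/2)²` — `θ = −1 ⟹ #Ш[2^∞] = 4`, `θ = +1 ⟹ 16 ∣ #Ш[2^∞]` — and -desc's rows T♯ / CT′ from the route's cruxes BY NAME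

Width prover seat `bsd-line-fkl-p2` g14 (2026-08-29), `--supports stmt-BirchSwinnertonDyer-23715` (helper).  THEOREMS ONLY; BSD is not proved by any of
this.  REF1 §146 graded -desc's DESC-27-T♯ `ResidueDoorVisibleFourSharpAtTwo` («`v₂(#Ш_an(W^{(d)})) = 2` if the Cassels–Tate form on `Ш(W^{(d)})[2]` is
non-degenerate, `≥ 4` if it vanishes») and CT′ `ResidueCasselsTateBitAtTwoAnalyticRankOne` CONJECTURE-GRADE «= BSD₂ to 2⁴; the θ-split is exactly right under
finiteness via Cassels' `M × M`».  This file PROVES the θ-split as pure group theory and reads both rows from existing statements BY NAME: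

§1 (finite abelian groups; [cite: SilvermanAEC2009, Exercise 10.20]; [cite: Cassels1962ArithmeticIV, Thm. 1.1]).  `A` finite with an alternating pairing
`B : A × A → ℚ/ℤ` with trivial kernel and `#A[2] = 4`.  (i) If some `c ∈ A[2]` is NOT twice an element (`θ = −1`) and `A` is `2`-primary then `A = A[2]`,
`#A = 4`: a character vanishing on `A[2]` is `y ↦ θ(2y)` (`ℚ/ℤ` divisible — Baer), characters are all of the form `B w` (`#Hom(A, ℚ/ℤ) = #A`), so a `c ∈ A[2]`
orthogonal to `A[2]` is `−2w`; hence some `x ∈ A[2]` pairs non-trivially with `c`, `A[2] = {0, c, x, x + c}` has trivial radical, and a non-zero `2a`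
would put a non-zero element of `2A ∩ A[2]` in that radical.  (ii) If every `c ∈ A[2]` is twice an element (`θ = +1`) then `8 ∣ #A = #A[2]·#2A` and `#A`
is a square (`isSquare_natCard_of_alternating_addCircle`), so `16 ∣ #A`.
§2 (`Ш`).  Granting the Cassels–Tate pairing (`exists_casselsTate_pairing`, PRINT, the named fact of `BSDSha.lean`; restricted to `Ш[2^∞]` by
`exists_pairing_primaryComponent_sha`): for `V/ℚ` with `Ш(V)[2^∞]` finite and `#Ш(V)[2] = 4`, `¬ ShaTwoInTwiceShaFour V ⟹ #Ш(V)[2^∞] = 4` and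
`ShaTwoInTwiceShaFour V ⟹ 16 ∣ #Ш(V)[2^∞]`; with `BSDp V 2` this is the CT-bit of `#Ш_an(V)` (`casselsTateBit_of_bsdp_two`).
§3 (rows).  T♯ on NON-CM curves ⟸ modularity + the four rank-`0` cruxes at `2` BY NAME + Cassels–Tate (`residueDoorVisibleFourSharp_nonCM_of_rankZero_cruxes`;
twin non-CM, analytic rank `0`, `BSDp Wd 2` by `bsdp_two_of_rankZero_cruxes`, `#Ш(Wd)[2] = 4` by the transport row X and `shaTwoCard_smul`); CT′ on the
crux's class ⟸ the crux BY NAME + Cassels–Tate (`residueCasselsTateBit_of_rankOneAtTwoBigImageOddLocal`).  CONDITIONAL by design; nothing asserted.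

References: [SilvermanAEC2009] X.§4, Thm. X.4.14, Exercise 10.20; [Cassels1962ArithmeticIV] Thm. 1.1; [Kramer1981] Thm. 1; [Miller2011LMS] Def. 1.1.
-/

set_option autoImplicit false
-- the Theorems namespace of this sub repeats the summit name by design (D-0017 nested layout)
set_option linter.dupNamespace false

noncomputable section

open scoped Classical

namespace Summit.BirchSwinnertonDyer.BirchSwinnertonDyer.Theorems.RankOneAtTwoOneDoor

open WeierstrassCurve NumberField Literature.NumberTheory.EllipticCurves Literature.NumberTheory.EllipticCurves.ModularForms
  Summit.BirchSwinnertonDyer.Rank1Residual.F1Sign2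
  Summit.BirchSwinnertonDyer.Rank1Residual.F1Sign2.TranspositionDoor
  Summit.BirchSwinnertonDyer.BirchSwinnertonDyer.Theses.ByReductionTypeAtTwo

/-! ### §1 Finite abelian groups with a non-degenerate alternating `ℚ/ℤ`-valued pairing -/

section Pairing

variable {A : Type*} [AddCommGroup A] [Finite A] (B : A →+ A →+ AddCircle (1 : ℚ))

omit [Finite A] in
/-- A character of an abelian group vanishing on `A[2]` is `y ↦ θ (2y)` for some character `θ` (factor through `2A`, extend by divisibility of `ℚ/ℤ` —
Baer's criterion). [cite: SilvermanAEC2009, Exercise 10.20] -/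
theorem exists_character_comp_two_nsmul (ψ : A →+ AddCircle (1 : ℚ)) (hψ : ∀ y : A, (2 : ℕ) • y = 0 → ψ y = 0) :
    ∃ θ : A →+ AddCircle (1 : ℚ), ∀ y : A, θ ((2 : ℕ) • y) = ψ y := by
  set D : A →+ A := nsmulAddMonoidHom (2 : ℕ) with hD
  have hDy : ∀ y : A, D y = (2 : ℕ) • y := fun _ => rfl
  have hsj : Function.Surjective D.rangeRestrict := D.rangeRestrict_surjective
  have hker : D.rangeRestrict.ker ≤ ψ.ker := by
    intro y hy
    rw [AddMonoidHom.mem_ker] at hy ⊢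
    have h2 : D y = 0 := by
      have := congrArg Subtype.val hy
      simpa only [AddMonoidHom.coe_rangeRestrict, ZeroMemClass.coe_zero] using this
    exact hψ y (by rw [← hDy]; exact h2)
  obtain ⟨θ, hθ⟩ := (Module.Baer.of_divisible (AddCircle (1 : ℚ))).extension_property_addMonoidHom D.range.subtype
    D.range.subtype_injective (D.rangeRestrict.liftOfSurjective hsj ⟨ψ, hker⟩)
  refine ⟨θ, fun y => ?_⟩
  have h := congrArg (fun f : D.range →+ AddCircle (1 : ℚ) => f (D.rangeRestrict y)) hθ
  simp only [AddMonoidHom.comp_apply, AddMonoidHom.liftOfRightInverse_comp_apply] at h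
  rw [← hDy]
  exact h

/-- With trivial left kernel, `a ↦ B a` is a bijection of the finite group `A` onto its character group (`#Hom(A, ℚ/ℤ) = #A`).
[cite: SilvermanAEC2009, Exercise 10.20] -/
theorem pairing_left_surjective (hnd : ∀ a, (∀ b, B a b = 0) → a = 0) : Function.Surjective (fun a : A => B a) := by
  have hinj : Function.Injective (fun a : A => B a) := by
    intro a b h
    have h' : B a = B b := h
    have h0 : ∀ y, B (a - b) y = 0 := fun y => by rw [map_sub, AddMonoidHom.sub_apply, h', sub_self]
    exact sub_eq_zero.mp (hnd _ h0)
  obtain ⟨e⟩ := Literature.GroupTheory.FiniteAbelian.nonempty_addMonoidHom_ratAddCircle_addEquiv A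
  exact (Finite.injective_iff_surjective_of_equiv e.toEquiv.symm).mp hinj

/-- In a finite abelian group with a non-degenerate alternating `ℚ/ℤ`-pairing, a `2`-torsion element orthogonal to `A[2]` is twice an element.
[cite: SilvermanAEC2009, Exercise 10.20] -/
theorem exists_two_nsmul_eq_of_orthogonal (halt : ∀ a, B a a = 0) (hnd : ∀ a, (∀ b, B a b = 0) → a = 0) {c : A}
    (horth : ∀ x : A, (2 : ℕ) • x = 0 → B x c = 0) : ∃ w : A, (2 : ℕ) • w = c := by
  obtain ⟨θ, hθ⟩ := exists_character_comp_two_nsmul (B.flip c) (fun y hy => by rw [AddMonoidHom.flip_apply]; exact horth y hy)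
  obtain ⟨w, hw⟩ := pairing_left_surjective B hnd θ
  have hw' : ∀ y, B w y = θ y := fun y => by rw [← hw]
  have key : ∀ y, B ((2 : ℕ) • w + c) y = 0 := fun y => by
    have h1 : B c y = -B y c := pairing_swap_eq_neg B halt y c
    have h2 : θ ((2 : ℕ) • y) = B y c := by rw [hθ, AddMonoidHom.flip_apply]
    rw [map_add, AddMonoidHom.add_apply, two_nsmul, map_add, AddMonoidHom.add_apply, h1, hw', ← map_add, ← two_nsmul, h2,
      add_neg_cancel]
  refine ⟨-w, ?_⟩
  have h0 : (2 : ℕ) • w + c = 0 := hnd _ key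
  rw [two_nsmul] at h0 ⊢
  have : c = -(w + w) := eq_neg_of_add_eq_zero_right h0
  rw [this, neg_add]

/-- **THE `θ = −1` HALF.**  `A` finite `2`-primary with a non-degenerate alternating `ℚ/ℤ`-pairing and `#A[2] = 4`; if some `c ∈ A[2]` is not twice an
element then `A = A[2]` (so `#A = 4`). [cite: SilvermanAEC2009, Exercise 10.20] [cite: Cassels1962ArithmeticIV, Thm. 1.1] -/
theorem two_nsmul_eq_zero_of_pairing (halt : ∀ a, B a a = 0) (hnd : ∀ a, (∀ b, B a b = 0) → a = 0)
    (hA : ∀ a : A, ∃ n : ℕ, 2 ^ n • a = 0) (h4 : ({a : A | (2 : ℕ) • a = 0} : Set A).ncard = 4)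
    {c : A} (hc : (2 : ℕ) • c = 0) (hndiv : ∀ w : A, (2 : ℕ) • w ≠ c) : ∀ a : A, (2 : ℕ) • a = 0 := by
  -- a `2`-torsion `x` pairing non-trivially with `c`
  obtain ⟨x, hx2, hxc⟩ : ∃ x : A, (2 : ℕ) • x = 0 ∧ B x c ≠ 0 := by
    by_contra! h
    obtain ⟨w, hw⟩ := exists_two_nsmul_eq_of_orthogonal B halt hnd h
    exact hndiv w hw
  have hc0 : c ≠ 0 := fun h => hxc (by rw [h, map_zero])
  have hx0 : x ≠ 0 := fun h => hxc (by rw [h, map_zero, AddMonoidHom.zero_apply])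
  have hxc' : x ≠ c := fun h => hxc (by rw [h, halt])
  have hxc0 : x + c ≠ 0 := fun h => hxc (by
    rw [eq_neg_of_add_eq_zero_left h, map_neg, AddMonoidHom.neg_apply, halt, neg_zero])
  have hcx : B c x ≠ 0 := by rw [pairing_swap_eq_neg B halt x c, neg_ne_zero]; exact hxc
  have hxpc : B (x + c) c ≠ 0 := by rwa [map_add, AddMonoidHom.add_apply, halt, add_zero]
  -- `A[2] = {0, c, x, x + c}`
  have hT : ∀ t : A, (2 : ℕ) • t = 0 → t = 0 ∨ t = c ∨ t = x ∨ t = x + c := by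
    intro t ht
    have hsub : ({0, c, x, x + c} : Set A) ⊆ {a : A | (2 : ℕ) • a = 0} := by
      intro s hs
      simp only [Set.mem_insert_iff, Set.mem_singleton_iff] at hs
      rcases hs with rfl | rfl | rfl | rfl
      · exact nsmul_zero _
      · exact hc
      · exact hx2
      · show (2 : ℕ) • (x + c) = 0
        rw [nsmul_add, hx2, hc, add_zero]
    have h4' : ({0, c, x, x + c} : Set A).ncard = 4 := by
      rw [Set.ncard_insert_of_notMem, Set.ncard_insert_of_notMem, Set.ncard_pair]
      · exact fun h => hc0 (add_left_cancel (a := x) (by rw [add_zero]; exact h)).symm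
      · simp only [Set.mem_insert_iff, Set.mem_singleton_iff, not_or]
        exact ⟨fun h => hxc' h.symm, fun h => hx0 (add_right_cancel (b := c) (by rw [zero_add]; exact h.symm))⟩
      · simp only [Set.mem_insert_iff, Set.mem_singleton_iff, not_or]
        exact ⟨fun h => hc0 h.symm, fun h => hx0 h.symm, fun h => hxc0 h.symm⟩
    have hEq : ({0, c, x, x + c} : Set A) = {a : A | (2 : ℕ) • a = 0} :=
      Set.eq_of_subset_of_ncard_le hsub (by rw [h4, h4'])
    have htS : t ∈ ({a : A | (2 : ℕ) • a = 0} : Set A) := ht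
    rw [← hEq] at htS
    simpa only [Set.mem_insert_iff, Set.mem_singleton_iff] using htS
  -- every `a` is `2`-torsion
  intro a
  by_contra hr
  have hex : ∃ n : ℕ, 2 ^ n • ((2 : ℕ) • a) = 0 := by
    obtain ⟨n, hn⟩ := hA a
    exact ⟨n, by rw [smul_smul, mul_comm, ← smul_smul, hn, smul_zero]⟩
  obtain ⟨n₀, hn₀, hmin⟩ : ∃ n₀ : ℕ, 2 ^ n₀ • ((2 : ℕ) • a) = 0 ∧ ∀ m < n₀, ¬ 2 ^ m • ((2 : ℕ) • a) = 0 :=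
    ⟨Nat.find hex, Nat.find_spec hex, fun m hm => Nat.find_min hex hm⟩
  obtain ⟨k, rfl⟩ : ∃ k, n₀ = k + 1 :=
    Nat.exists_eq_succ_of_ne_zero (by rintro rfl; exact hr (by rwa [pow_zero, one_smul] at hn₀))
  set s : A := 2 ^ k • ((2 : ℕ) • a) with hs
  have hs0 : s ≠ 0 := hmin k (Nat.lt_succ_self k)
  have hs2 : (2 : ℕ) • s = 0 := by rw [hs, smul_smul, ← pow_succ', hn₀]
  have hsorth : ∀ t : A, (2 : ℕ) • t = 0 → B s t = 0 := fun t ht => by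
    have e : s = 2 ^ k • a + 2 ^ k • a := by rw [hs, two_nsmul, nsmul_add]
    rw [e, map_add, AddMonoidHom.add_apply, ← map_add, ← two_nsmul, ht, map_zero]
  rcases hT s hs2 with h | h | h | h
  · exact hs0 h
  · exact hcx (by rw [← h]; exact hsorth x hx2)
  · exact hxc (by rw [← h]; exact hsorth c hc)
  · exact hxpc (by rw [← h]; exact hsorth c hc)

/-- **THE `θ = +1` HALF.**  `A` finite with a non-degenerate alternating `ℚ/ℤ`-pairing and `#A[2] = 4`; if every element of `A[2]` is twice an element then
`16 ∣ #A` (`#A = #A[2]·#2A` with `2 ∣ #2A`, and `#A` is a square). [cite: SilvermanAEC2009, Exercise 10.20] [cite: Cassels1962ArithmeticIV, Thm. 1.1] -/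
theorem sixteen_dvd_natCard_of_pairing (halt : ∀ a, B a a = 0) (hnd : ∀ a, (∀ b, B a b = 0) → a = 0)
    (h4 : ({a : A | (2 : ℕ) • a = 0} : Set A).ncard = 4) (hdiv : ∀ c : A, (2 : ℕ) • c = 0 → ∃ w : A, (2 : ℕ) • w = c) :
    16 ∣ Nat.card A := by
  have hsq : IsSquare (Nat.card A) := isSquare_natCard_of_alternating_addCircle A B halt hnd
  set D : A →+ A := nsmulAddMonoidHom (2 : ℕ) with hD
  have hDy : ∀ y : A, D y = (2 : ℕ) • y := fun _ => rfl
  have hcardA : Nat.card A = Nat.card D.range * Nat.card D.ker := by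
    rw [← Nat.card_congr (QuotientAddGroup.quotientKerEquivRange D).toEquiv]
    exact AddSubgroup.card_eq_card_quotient_mul_card_addSubgroup D.ker
  have hker : Nat.card D.ker = 4 := by
    rw [← h4, ← Nat.card_coe_set_eq]
    exact Nat.card_congr (Equiv.subtypeEquivRight fun a => by rw [AddMonoidHom.mem_ker, hDy, Set.mem_setOf_eq])
  -- a non-zero `2`-torsion element, twice an element, of order `2` in `2A`
  obtain ⟨c, hc, hc0⟩ : ∃ c : A, (2 : ℕ) • c = 0 ∧ c ≠ 0 := by
    by_contra! h
    have h1 : ({a : A | (2 : ℕ) • a = 0} : Set A) = {0} := by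
      ext a
      simp only [Set.mem_setOf_eq, Set.mem_singleton_iff]
      exact ⟨h a, fun ha => by rw [ha, nsmul_zero]⟩
    rw [h1, Set.ncard_singleton] at h4
    omega
  obtain ⟨w, hw⟩ := hdiv c hc
  have hmem : c ∈ D.range := ⟨w, by rw [hDy, hw]⟩
  have hord : addOrderOf (⟨c, hmem⟩ : D.range) = 2 := by
    rw [← AddSubgroup.addOrderOf_coe]
    exact addOrderOf_eq_prime hc hc0
  have h2r : 2 ∣ Nat.card D.range := hord ▸ addOrderOf_dvd_natCard (⟨c, hmem⟩ : D.range)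
  have h8 : 8 ∣ Nat.card A := by
    rw [hcardA, hker]
    obtain ⟨m, hm⟩ := h2r
    exact ⟨m, by rw [hm]; ring⟩
  obtain ⟨m, hm⟩ := hsq
  rw [hm] at h8 ⊢
  have h2m : 2 ∣ m := ((Nat.Prime.dvd_mul Nat.prime_two).mp (dvd_trans (by norm_num) h8)).elim id id
  obtain ⟨m₁, rfl⟩ := h2m
  have h2m₁ : 2 ∣ m₁ := by
    have : 2 ∣ m₁ * m₁ := by
      have h8' : 8 ∣ 4 * (m₁ * m₁) := by rw [show 2 * m₁ * (2 * m₁) = 4 * (m₁ * m₁) by ring] at h8; exact h8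
      omega
    exact ((Nat.Prime.dvd_mul Nat.prime_two).mp this).elim id id
  obtain ⟨m₂, rfl⟩ := h2m₁
  exact ⟨m₂ * m₂, by ring⟩

/-- In a finite `2`-primary group, `2 ^ #A` kills everything (the order of an element is a power of `2` at most `#A`). [folklore] -/
theorem two_pow_natCard_nsmul_eq_zero (hA : ∀ a : A, ∃ n : ℕ, 2 ^ n • a = 0) (y : A) : 2 ^ Nat.card A • y = 0 := by
  obtain ⟨n, hn⟩ := hA y
  obtain ⟨j, -, hj⟩ := (Nat.dvd_prime_pow Nat.prime_two).mp (addOrderOf_dvd_of_nsmul_eq_zero hn)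
  have hjle : 2 ^ j ≤ Nat.card A := hj ▸ Nat.le_of_dvd Nat.card_pos (addOrderOf_dvd_natCard y)
  have hjlt : j < Nat.card A := lt_of_lt_of_le j.lt_two_pow_self hjle
  obtain ⟨m, hm⟩ := pow_dvd_pow 2 hjlt.le
  rw [hm, mul_comm, ← smul_smul, ← hj, addOrderOf_nsmul_eq_zero, smul_zero]

end Pairing

/-! ### §2 `Ш(V)[2^∞]` finite with `#Ш(V)[2] = 4`: the Cassels–Tate bit -/

/-- `#Ш[2]` is a model invariant: `shaTwoCard (C • V) = shaTwoCard V` (along `galH1Equiv`, `mem_sha_iff_galH1Equiv_mem`). [cite: SilvermanAEC2009, X.§4] -/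
theorem shaTwoCard_smul (V : WeierstrassCurve ℚ) (C : VariableChange ℚ) : shaTwoCard (C • V) = shaTwoCard V := by
  unfold shaTwoCard
  refine (Nat.card_congr ((galH1Equiv V C).toEquiv.subtypeEquiv fun c => ?_)).symm
  change c ∈ V.sha ⊓ AddSubgroup.torsionBy V.galH1 (2 : ℕ) ↔ (galH1Equiv V C) c ∈ (C • V).sha ⊓ AddSubgroup.torsionBy (C • V).galH1 (2 : ℕ)
  rw [AddSubgroup.mem_inf, AddSubgroup.mem_inf, AddSubgroup.torsionBy.nsmul_iff, AddSubgroup.torsionBy.nsmul_iff, ← map_nsmul,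
    (galH1Equiv V C).map_eq_zero_iff]
  exact and_congr (mem_sha_iff_galH1Equiv_mem V C c) Iff.rfl

/-- `#{a ∈ Ш(V)[2^∞] | 2a = 0} = shaTwoCard V = #Ш(V)[2]` (the `2`-torsion of `Ш` lies in `Ш[2^∞]`). [cite: SilvermanAEC2009, X.§4] -/
theorem ncard_two_torsion_primaryComponent_eq_shaTwoCard (V : WeierstrassCurve ℚ) :
    ({a : AddCommGroup.primaryComponent V.sha 2 | (2 : ℕ) • a = 0} : Set (AddCommGroup.primaryComponent V.sha 2)).ncard = shaTwoCard V := by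
  rw [← Nat.card_coe_set_eq]
  unfold shaTwoCard
  have key : ∀ a : AddCommGroup.primaryComponent V.sha 2, (2 : ℕ) • a = 0 ↔ (2 : ℕ) • ((a : V.sha) : V.galH1) = 0 := fun a => by
    simp only [Subtype.ext_iff, AddSubgroupClass.coe_nsmul, ZeroMemClass.coe_zero]
  refine Nat.card_congr
    { toFun := fun a => ⟨((a.1 : V.sha) : V.galH1), AddSubgroup.mem_inf.mpr ⟨(a.1 : V.sha).2, AddSubgroup.torsionBy.nsmul_iff.mpr ((key a.1).mp a.2)⟩⟩
      invFun := fun c => ⟨⟨⟨c.1, (AddSubgroup.mem_inf.mp c.2).1⟩, (AddCommGroup.mem_primaryComponent).mpr ⟨1, Subtype.ext (by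
          rw [pow_one, AddSubgroupClass.coe_nsmul, ZeroMemClass.coe_zero]
          exact AddSubgroup.torsionBy.nsmul_iff.mp (AddSubgroup.mem_inf.mp c.2).2)⟩⟩, (key _).mpr (by
          exact AddSubgroup.torsionBy.nsmul_iff.mp (AddSubgroup.mem_inf.mp c.2).2)⟩
      left_inv := fun a => by ext; rfl
      right_inv := fun c => by ext; rfl }

/-- **THE CASSELS–TATE BIT OF A FINITE `Ш[2^∞]` WITH `Ш[2] ≅ (ℤ/2)²`** (granting the Cassels–Tate pairing `exists_casselsTate_pairing`, PRINT): for `V/ℚ`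
elliptic with `Ш(V)[2^∞]` finite and `#Ш(V)[2] = 4`: if the Cassels–Tate form on `Ш(V)[2]` is non-degenerate (`θ(V) = −1`, `¬ ShaTwoInTwiceShaFour V`) then
`#Ш(V)[2^∞] = 4`; if it vanishes (`θ(V) = +1`, `ShaTwoInTwiceShaFour V`) then `16 ∣ #Ш(V)[2^∞]`.  (Cassels' `M × M`: `Ш[2^∞] ≅ (ℤ/2^a)²`, `θ = +1 ⟺ a ≥ 2`.)
CONDITIONAL on the named printed fact only. [cite: Cassels1962ArithmeticIV, Thm. 1.1] [cite: SilvermanAEC2009, Thm. X.4.14 and Exercise 10.20] -/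
theorem natCard_primaryComponent_sha_two_casselsTate_bit (hCT : exists_casselsTate_pairing (K := ℚ)) (V : WeierstrassCurve ℚ) [V.IsElliptic]
    [Finite (AddCommGroup.primaryComponent V.sha 2)] (h4 : shaTwoCard V = 4) :
    (¬ ShaTwoInTwiceShaFour V → Nat.card (AddCommGroup.primaryComponent V.sha 2) = 4) ∧
      (ShaTwoInTwiceShaFour V → 16 ∣ Nat.card (AddCommGroup.primaryComponent V.sha 2)) := by
  set A : AddSubgroup V.sha := AddCommGroup.primaryComponent V.sha 2 with hAdef
  obtain ⟨hA, -, BA, halt, hkerBA⟩ := exists_pairing_primaryComponent_sha V (p := 2) hCT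
  have hnd : ∀ a : A, (∀ b, BA a b = 0) → a = 0 := by
    intro a ha
    obtain ⟨y, hy⟩ := hkerBA a ha (Nat.card A)
    rw [← hy, nsmulAddMonoidHom_apply]
    exact two_pow_natCard_nsmul_eq_zero hA y
  have h4' : ({a : A | (2 : ℕ) • a = 0} : Set A).ncard = 4 := by rw [hAdef, ncard_two_torsion_primaryComponent_eq_shaTwoCard V, h4]
  have key : ∀ a : A, (2 : ℕ) • a = 0 ↔ (2 : ℕ) • ((a : V.sha) : V.galH1) = 0 := fun a => by
    simp only [Subtype.ext_iff, AddSubgroupClass.coe_nsmul, ZeroMemClass.coe_zero]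
  have key' : ∀ a w : A, (2 : ℕ) • w = a ↔ (2 : ℕ) • ((w : V.sha) : V.galH1) = ((a : V.sha) : V.galH1) := fun a w => by
    simp only [Subtype.ext_iff, AddSubgroupClass.coe_nsmul]
  refine ⟨fun hθ => ?_, fun hθ => ?_⟩
  · -- `θ = −1`: some `c ∈ Ш[2]` is not twice a class of `Ш`
    obtain ⟨c, hcmem, hc2, hcn⟩ : ∃ c ∈ V.sha, (2 : ℕ) • c = 0 ∧ ∀ c' ∈ V.sha, (4 : ℕ) • c' = 0 → (2 : ℕ) • c' ≠ c := by
      by_contra! h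
      exact hθ h
    set a : A := ⟨⟨c, hcmem⟩, (AddCommGroup.mem_primaryComponent).mpr ⟨1, Subtype.ext (by
      rw [pow_one, AddSubgroupClass.coe_nsmul, ZeroMemClass.coe_zero]; exact hc2)⟩⟩ with ha
    have ha2 : (2 : ℕ) • a = 0 := (key a).mpr hc2
    have hndiv : ∀ w : A, (2 : ℕ) • w ≠ a := by
      intro w hw
      have hw' : (2 : ℕ) • ((w : V.sha) : V.galH1) = c := (key' a w).mp hw
      refine hcn _ (w : V.sha).2 ?_ hw'
      rw [show (4 : ℕ) = 2 * 2 by norm_num, mul_smul, hw', hc2]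
    have hall := two_nsmul_eq_zero_of_pairing BA halt hnd hA h4' ha2 hndiv
    rw [← h4', ← Nat.card_coe_set_eq]
    exact Nat.card_congr (Equiv.subtypeUnivEquiv hall).symm
  · -- `θ = +1`: every class of `Ш[2]` is twice a class of `Ш[4]`
    refine sixteen_dvd_natCard_of_pairing BA halt hnd h4' fun b hb => ?_
    obtain ⟨c', hc'mem, hc'4, hc'2⟩ := hθ ((b : V.sha) : V.galH1) (b : V.sha).2 ((key b).mp hb)
    refine ⟨⟨⟨c', hc'mem⟩, (AddCommGroup.mem_primaryComponent).mpr ⟨2, Subtype.ext (by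
      rw [AddSubgroupClass.coe_nsmul, ZeroMemClass.coe_zero]; exact hc'4)⟩⟩, (key' b _).mpr hc'2⟩

/-- **THE CT-BIT OF `#Ш_an` UNDER `BSDp V 2`**: granting Cassels–Tate, for `V/ℚ` with `BSDp V 2` (`#Ш_an(V) = q`, `v₂(q) = ord₂ #Ш(V)[2^∞]`, `Ш(V)[2^∞]`
finite) and `#Ш(V)[2] = 4`: `v₂(q) = 2` if `θ(V) = −1`, `v₂(q) ≥ 4` if `θ(V) = +1`.  CONDITIONAL by design. [cite: Cassels1962ArithmeticIV, Thm. 1.1]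
[cite: Miller2011LMS, Def. 1.1] -/
theorem casselsTateBit_of_bsdp_two (hCT : exists_casselsTate_pairing (K := ℚ)) (V : WeierstrassCurve ℚ) [V.IsElliptic] (hB : BSDp V 2)
    (h4 : shaTwoCard V = 4) :
    ∃ q : ℚ, shaAn V = (q : ℂ) ∧ (¬ ShaTwoInTwiceShaFour V → padicValRat 2 q = 2) ∧ (ShaTwoInTwiceShaFour V → 4 ≤ padicValRat 2 q) := by
  obtain ⟨-, hfin, q, hq, hv⟩ := hB
  haveI := hfin
  have hbit := natCard_primaryComponent_sha_two_casselsTate_bit hCT V h4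
  refine ⟨q, hq, fun hθ => ?_, fun hθ => ?_⟩
  · rw [hv, hbit.1 hθ, show (4 : ℕ) = 2 ^ 2 by norm_num, padicValNat.prime_pow]
    norm_num
  · rw [hv]
    exact_mod_cast (padicValNat_dvd_iff_le (Nat.card_pos (α := AddCommGroup.primaryComponent V.sha 2)).ne').mp
      (by norm_num; exact hbit.2 hθ)

/-! ### §3 -desc's rows T♯ and CT′ from the route's statements BY NAME -/

/-- **DESC-27-T♯ ON NON-CM CURVES FROM THE ROUTE'S RANK-`0` CRUXES + CASSELS–TATE.**  `W/ℚ` globally minimal, NON-CM, on the egg residue `OnResidueAtTwo W`;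
`d` desc-admissible with `L(W^{(d)},1) ≠ 0`; `Wd` a globally minimal model of the twist.  THEN `#Ш_an(Wd) = q ∈ ℚ` with `v₂(q) = 2` if the Cassels–Tate
form on `Ш(Wd)[2]` is non-degenerate and `v₂(q) ≥ 4` if it vanishes — modulo modularity, the four rank-`0` cruxes at `2` BY NAME (`BSDp Wd 2` through
`bsdp_two_of_rankZero_cruxes`: the twin is non-CM of analytic rank `0`), and the Cassels–Tate pairing (PRINT); `#Ш(Wd)[2] = 4` is the PROVED transport row X
(`residueDoorShaTwoTransportCardAtTwo_holds`, `shaTwoCard_smul`).  With `t_of_tSharp` this re-derives T.  CONDITIONAL by design; nothing is asserted about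
the cruxes. [cite: Kramer1981, Thm. 1] [cite: Cassels1962ArithmeticIV, Thm. 1.1] [cite: Miller2011LMS, Def. 1.1] -/
theorem residueDoorVisibleFourSharp_nonCM_of_rankZero_cruxes (hnf : exists_isNewformOf)
    (hZ4 : GoodOrdinaryRankZeroAtTwo ∧ MultiplicativeRankZeroAtTwo ∧ SupersingularRankZeroAtTwo ∧ AdditiveRankZeroAtTwo)
    (hCT : exists_casselsTate_pairing (K := ℚ))
    (W : WeierstrassCurve ℚ) [W.IsElliptic] [W.IsGloballyMinimal] (hCM : ¬ W.HasCM) (hres : OnResidueAtTwo W)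
    {d : ℤ} (hd : DescAdmissible W d) (hLt : (W.quadraticTwist (d : ℚ)).entireLFunction 1 ≠ 0)
    (Wd : WeierstrassCurve ℚ) [Wd.IsElliptic] [Wd.IsGloballyMinimal] (Cd : VariableChange ℚ) (hWd : Cd • W.quadraticTwist (d : ℚ) = Wd) :
    ∃ q : ℚ, shaAn Wd = (q : ℂ) ∧ (¬ ShaTwoInTwiceShaFour Wd → padicValRat 2 q = 2) ∧ (ShaTwoInTwiceShaFour Wd → 4 ≤ padicValRat 2 q) := by
  have hmod : hasEntireLFunction_rat := hasEntireLFunction_rat_of_exists_isNewformOf hnf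
  have hd0 : (d : ℚ) ≠ 0 := by exact_mod_cast (ne_of_lt hd.1)
  haveI hEt : (W.quadraticTwist (d : ℚ)).IsElliptic := W.isElliptic_quadraticTwist hd0
  have hCMd : ¬ Wd.HasCM := RamifiedPairUpperBound.not_hasCM_of_smul_quadraticTwist_eq hd0 hWd hCM
  have hLeq : Wd.entireLFunction = (W.quadraticTwist (d : ℚ)).entireLFunction := by rw [← hWd, entireLFunction_smul]
  have hrd : Wd.analyticRank = 0 := (Wd.analyticRank_eq_zero_iff_holds (hmod Wd)).2 (by rw [hLeq]; exact hLt)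
  have hB : BSDp Wd 2 := bsdp_two_of_rankZero_cruxes hZ4 Wd hCMd hrd
  have hr0 : (W.quadraticTwist (d : ℚ)).mordellWeilRank = 0 := by
    rw [← mordellWeilRank_variableChange_holds (W.quadraticTwist (d : ℚ)) Cd, hWd, hB.1, hrd]
  have h4 : shaTwoCard Wd = 4 := by
    rw [← hWd, shaTwoCard_smul]
    exact residueDoorShaTwoTransportCardAtTwo_holds W hres d hd hr0
  exact casselsTateBit_of_bsdp_two hCT Wd hB h4

/-- **DESC-27-CT′ ON THE CRUX'S CLASS FROM THE CRUX BY NAME + CASSELS–TATE.**  Granting `RankOneAtTwoBigImageOddLocal` (the crux, as a HYPOTHESIS — nothing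
is asserted about it) and the Cassels–Tate pairing: every globally minimal non-CM `W/ℚ` with surjective `2`-adic tower, odd torsion, odd Tamagawa product,
analytic rank `1` and `#Ш(W)[2] = 4` has `#Ш_an(W) = q` with `v₂(q) = 2` (`θ(W) = −1`) / `≥ 4` (`θ(W) = +1`).  CONDITIONAL by design.
[cite: Cassels1962ArithmeticIV, Thm. 1.1] [cite: Miller2011LMS, Def. 1.1] -/
theorem residueCasselsTateBit_of_rankOneAtTwoBigImageOddLocal (hX : RankOneAtTwoBigImageOddLocal) (hCT : exists_casselsTate_pairing (K := ℚ))
    (W : WeierstrassCurve ℚ) [W.IsElliptic] [W.IsGloballyMinimal] (hCM : ¬ W.HasCM)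
    (hsurj : ∀ n : ℕ, W.HasSurjectiveModNGaloisRep ((2 ^ n : ℕ) : ℤ)) (hT : Odd W.torsionOrder) (hc : Odd W.tamagawaProduct)
    (hr : W.analyticRank = 1) (h4 : shaTwoCard W = 4) :
    ∃ q : ℚ, shaAn W = (q : ℂ) ∧ (¬ ShaTwoInTwiceShaFour W → padicValRat 2 q = 2) ∧ (ShaTwoInTwiceShaFour W → 4 ≤ padicValRat 2 q) :=
  casselsTateBit_of_bsdp_two hCT W (hX W hCM hsurj hT hc hr) h4

end Summit.BirchSwinnertonDyer.BirchSwinnertonDyer.Theorems.RankOneAtTwoOneDoor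

end
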